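import Literature.LinearAlgebra.Matrix.LatimerMacDuffeeSquarefree
import Mathlib.RingTheory.Artinian.Module
import Mathlib.RingTheory.Nilpotent.Basic
import HarnessLib

/-!
# Hertling–Larabi 2026 §6: the `ε`-classes over an order are finite iff `A` is separable (Theorems 6.3, 6.4)

[topic NumberTheory/ComplexMultiplication] General-`A` series (`FiniteQAlgebraLatticePowersInvertible`: full lattices,
orders, `L₁:L₂` in an arbitrary finite-dimensional commutative `ℚ`-algebra `A`). Source: C. Hertling, K. Larabi,
*Semigroups from full lattices in commutative ℚ-algebras*, arXiv:2602.14973 (2026) [HertlingLarabi2026], §6,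
chunk p0015, VERBATIM:

«Theorem 6.3. (Special case of the Jordan-Zassenhaus theorem) Let `A` be separable. For any order `Λ` in `A` the
set `{[L]_ε | L ∈ 𝓛(A), 𝒪(L) ⊃ Λ}` of `ε`-classes of `Λ`-ideals is finite.
Theorem 6.3 does not hold for `A` not separable, as the following construction of Faddeev shows.
Theorem 6.4 (Fa65). Suppose that `A` is not separable, so its radical `R` is not `0`. Let `Λ` be an order in `A`.
Then the set `{Γ ∈ 𝓛(A) | Γ an order, Γ ⊃ Λ}` is infinite. And therefore the set
`{[L]_ε | L ∈ 𝓛(A), 𝒪(L) ⊃ Λ}` is infinite.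
Proof: For example, the following is an infinite sequence of orders `Λ_m` with `Λ ⊊ Λ_1 ⊊ Λ_2 ⊊ …`,
`Λ_m := Λ + Σ_{l=1}^{n_max} 2^{-lm} (Λ ∩ R)^l` for `m ∈ ℕ` […]. The second statement follows from the first
statement and from the following basic observation: `Λ_1, Λ_2 ∈ 𝓛(A)` orders with `[Λ_1]_ε = [Λ_2]_ε ⟹ Λ_1 = Λ_2`,
which follows from `Λ_1 = 𝒪(Λ_1) = 𝒪(Λ_2) = Λ_2`.»

and [HertlingLarabi2026b] (*Conjugacy classes of regular integer matrices*, arXiv:2602.15748) Thm. 3.1 (iii),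
chunk p0006: «`R` is the radical, namely the
intersection of the maximal ideals and the set of all nilpotent elements of `A`. […] (iii) `A` is separable if and
only if `A = F`, so if and only if `R = {0}`.»; Cor. 5.4, chunk p0009 (= Thm. 6.3 above); before Thm. 4.8, chunk
p0007: «For separable `A` it follows easily, using the decomposition `A = ⊕_{j=1}^k A^{(j)}` into algebraic number
fields `A^{(j)}`.»

The tree's `CMAlgebraLatticeClassesFinite.finite_quot_isFullLattice_of_isFullLattice` is Theorem 6.3 «AS PRINTED for
`A = Y = L_1 ⊕ ⋯ ⊕ L_t`» (a LITERAL product of number fields). Here: Theorem 6.3 for every separable `A`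
(`IsReduced A`: no nonzero nilpotents, i.e. `R = 0`), by the structure theorem `A ≅ ∏_𝔪 A/𝔪` for reduced
artinian rings (Mathlib's `IsArtinianRing.equivPi`) and the transport of `ε`-classes along ring isomorphisms
(`LatimerMacDuffeeSquarefree.finite_quot_of_ringEquiv`); and Theorem 6.4 (Faddeev), whence the dichotomy.

## What is formalised (`A` a finite-dimensional commutative `ℚ`-algebra; lattices are `ℤ`-submodules; the classes
## of full lattices `M` with `MΛ ⊆ M` modulo `M ∼ uM`, `u ∈ A^×`, as a `Quot` type, exactly as in the `Y`-series)

* §1 **THEOREM 6.3 for separable `A`** (`finite_quot_isFullLattice_of_isReduced`): for ANY full lattice `Λ` (in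
  particular any order) of a reduced `A`, the `ε`-classes of full lattices `M` with `MΛ ⊆ M` form a finite type.
  Each `A/𝔪` is a number field (`ℚ`-algebra quotient of a finite-dimensional one); `Λ ↦ e(Λ)` is full.
* §2 **THEOREM 6.4 (Faddeev)**: `R ≠ 0` gives `r ≠ 0` with `r² = 0`, scaled into `Λ`; the full lattices
  `Λ_m := Λ + 2^{-m} r Λ` (HL's `Λ_m` with the single nilpotent `r`, `n_max`-sum collapsing to `l = 1`) are orders
  containing `Λ` (`LatimerMacDuffeeSquarefree.sup_span_mul_mul_le`), increasing in `m`, and no order — indeed no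
  full lattice — contains `2^{-m} r` for all `m` (`eq_zero_of_forall_inv_pow_smul_mem`), so each `Λ_m` recurs only
  finitely often (`exists_orders_nat`): **the orders `Γ ⊇ Λ` form an infinite set**
  (`infinite_setOf_order_of_not_isReduced`) and, `ε`-equivalent orders being equal
  (`LatimerMacDuffeeSquarefree.eq_of_units_smul_eq_of_one_mem`), **the `ε`-classes of full lattices `M` with
  `MΛ ⊆ M` form an infinite type** (`infinite_quot_isFullLattice_of_not_isReduced`).
* §3 the dichotomy **`Finite {[L]_ε | 𝒪(L) ⊇ Λ} ⟺ A separable`** for every order `Λ`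
  (`finite_quot_isFullLattice_iff_isReduced`).
NOT here: HL 2026 Thm. 6.5 (finiteness of the classes of EXACT `Λ`-ideals for every `A`), the strict chain
`Λ_m ⊊ Λ_{m+1}` and `pr_F` (HL26b Rem. 5.11 (i)).

## References
* [HertlingLarabi2026] C. Hertling, K. Larabi, *Semigroups from full lattices in commutative ℚ-algebras*,
  arXiv:2602.14973 (2026), §6 Thm. 6.3, Thm. 6.4 and the «basic observation» in its proof.
  [cite: HertlingLarabi2026, §6 Thms. 6.3–6.4, chunk p0015]
* [HertlingLarabi2026b] C. Hertling, K. Larabi, arXiv:2602.15748 (2026), Thm. 3.1 (iii), §4 (before Thm. 4.8),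
  Cor. 5.4, Rem. 5.11 (i). [cite: HertlingLarabi2026b, §5 Cor. 5.4, chunk p0009]
* [DadeTausskyZassenhaus1962] (the `Y`-case in the tree, `CMAlgebraLatticeClassesFinite`).
-/

noncomputable section

open scoped Classical Pointwise
open Submodule Module

namespace Literature.NumberTheory.ComplexMultiplication.FiniteQAlgebraLattice

open Literature.NumberTheory.Automorphic (IsFullLattice)
open Literature.LinearAlgebra.Matrix.LatimerMacDuffeeSquarefree (isFullLattice_map finite_quot_of_ringEquiv
  equivalence_exists_units_smul eq_of_units_smul_eq_of_one_mem sup_span_mul_mul_le)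

/-! ## §1 Theorem 6.3 for a separable algebra -/

/-- Stability transports along a ring isomorphism: `MΛ ⊆ M ⟹ e(M)e(Λ) ⊆ e(M)`. [folklore] -/
private theorem forall_mul_mem_map {A A' : Type*} [Ring A] [Ring A'] (e : A ≃+* A') {Λ M : Submodule ℤ A}
    (h : ∀ m ∈ M, ∀ a ∈ Λ, m * a ∈ M) :
    ∀ m' ∈ M.map (e : A →+ A').toIntLinearMap, ∀ a' ∈ Λ.map (e : A →+ A').toIntLinearMap,
      m' * a' ∈ M.map (e : A →+ A').toIntLinearMap := by
  rintro _ ⟨m, hm, rfl⟩ _ ⟨a, ha, rfl⟩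
  exact ⟨m * a, h m hm a ha, by simp⟩

variable {A : Type} [CommRing A] [Algebra ℚ A]

/-- **THEOREM 6.3 («Special case of the Jordan-Zassenhaus theorem») for every SEPARABLE `A`: «Let `A` be separable.
For any order `Λ` in `A` the set `{[L]_ε | L ∈ 𝓛(A), 𝒪(L) ⊃ Λ}` of `ε`-classes of `Λ`-ideals is finite.»** Here
«separable» is `R = 0` (`IsReduced A`, HL26b Thm. 3.1 (iii)), `Λ` may be any full lattice, and `𝒪(L) ⊇ Λ` is
spelled `LΛ ⊆ L`. Proof «using the decomposition `A = ⊕_j A^{(j)}` into algebraic number fields»: `A ≅ ∏_𝔪 A/𝔪`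
(reduced artinian), each `A/𝔪` a number field, the image of `Λ` is a full lattice, the `Y`-theorem of the tree
applies, and `ε`-classes transport injectively. [cite: HertlingLarabi2026, §6 Thm. 6.3, chunk p0015]
[cite: HertlingLarabi2026b, §5 Cor. 5.4, chunk p0009; §4 (before Thm. 4.8), chunk p0007] [cite: DadeTausskyZassenhaus1962, title theorem] -/
theorem finite_quot_isFullLattice_of_isReduced [Module.Finite ℚ A] [IsReduced A] (Λ : Submodule ℤ A)
    (hΛ : IsFullLattice A Λ) :
    Finite (Quot fun M M' : {M : Submodule ℤ A // IsFullLattice A M ∧ ∀ m ∈ M, ∀ a ∈ Λ, m * a ∈ M} =>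
      ∃ u : Aˣ, u • M.1 = M'.1) := by
  haveI : IsArtinianRing A := IsArtinianRing.of_finite ℚ A
  letI : Fintype (MaximalSpectrum A) := Fintype.ofFinite _
  letI : ∀ i : MaximalSpectrum A, Field (A ⧸ i.asIdeal) := fun i => Ideal.Quotient.field i.asIdeal
  haveI : ∀ i : MaximalSpectrum A, NumberField (A ⧸ i.asIdeal) := fun i =>
    { to_charZero := algebraRat.charZero (A ⧸ i.asIdeal)
      to_finiteDimensional := by
        convert! (inferInstance : Module.Finite ℚ (A ⧸ i.asIdeal))
        exact Subsingleton.elim _ _ }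
  let e : A ≃+* (Π i : MaximalSpectrum A, A ⧸ i.asIdeal) := (IsArtinianRing.equivPi A).toRingEquiv
  have hfin := finite_quot_isFullLattice_of_isFullLattice
    (L := fun i : MaximalSpectrum A => A ⧸ i.asIdeal) _ (isFullLattice_map e hΛ)
  exact finite_quot_of_ringEquiv e (fun M hM => ⟨isFullLattice_map e hM.1, forall_mul_mem_map e hM.2⟩) hfin

/-! ## §2 Theorem 6.4 (Faddeev): infinitely many orders when `R ≠ 0` -/

omit [Algebra ℚ A] in
/-- «`A` is not separable, so its radical `R` is not `0`»: a non-reduced `A` contains `r ≠ 0` with `r² = 0`.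
[cite: HertlingLarabi2026b, §3 Thm. 3.1 (iii) («`R` is […] the set of all nilpotent elements […] `A` is separable
[…] if and only if `R = {0}`»), chunk p0006] -/
theorem exists_ne_zero_mul_self_eq_zero_of_not_isReduced (hA : ¬IsReduced A) :
    ∃ r : A, r ≠ 0 ∧ r * r = 0 := by
  rw [isReduced_iff_pow_one_lt 2 one_lt_two] at hA
  simp only [not_forall] at hA
  obtain ⟨x, hx2, hx0⟩ := hA
  exact ⟨x, hx0, by rw [← sq, hx2]⟩

/-- A full lattice cannot contain `2^{-k} r` for all `k ≥ K` unless `r = 0`: the coordinates of `r` in a `ℤ`-basis of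
the lattice would be rationals divisible by every power of `2` — the step «`Λ ⊊ Λ_1 ⊊ Λ_2 ⊊ …`» of Faddeev's
construction in the form used here (no full lattice contains the whole sequence `2^{-m} r`).
[cite: HertlingLarabi2026, §6 Thm. 6.4 (proof), chunk p0015] -/
theorem eq_zero_of_forall_inv_pow_smul_mem {L : Submodule ℤ A} (hL : IsFullLattice A L) {r : A} {K : ℕ}
    (h : ∀ k, K ≤ k → ((2 : ℚ) ^ k)⁻¹ • r ∈ L) : r = 0 := by
  obtain ⟨b, hb⟩ := exists_basis_fin_span_eq hL
  refine b.ext_elem fun i => ?_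
  rw [map_zero, Finsupp.zero_apply]
  by_contra hne
  obtain ⟨N, hN⟩ := pow_unbounded_of_one_lt |b.repr r i| (by norm_num : (1 : ℚ) < 2)
  have hmem := h (max K N) (le_max_left _ _)
  rw [← hb, Basis.mem_span_iff_repr_mem] at hmem
  obtain ⟨z, hz⟩ := hmem i
  rw [map_smul, Finsupp.smul_apply, smul_eq_mul] at hz
  have h2 : (0 : ℚ) < (2 : ℚ) ^ max K N := pow_pos (by norm_num) _
  have hz' : (z : ℚ) = ((2 : ℚ) ^ max K N)⁻¹ * b.repr r i := by
    rw [← eq_intCast (algebraMap ℤ ℚ) z]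
    exact hz
  have hc : b.repr r i = (z : ℚ) * (2 : ℚ) ^ max K N := by
    rw [hz', mul_comm (((2 : ℚ) ^ max K N)⁻¹) (b.repr r i), inv_mul_cancel_right₀ h2.ne']
  have hz0 : z ≠ 0 := by
    rintro rfl
    rw [Int.cast_zero, zero_mul] at hc
    exact hne hc
  have h1 : (1 : ℚ) ≤ |(z : ℚ)| := by exact_mod_cast Int.one_le_abs hz0
  have hle : (2 : ℚ) ^ N ≤ |b.repr r i| := by
    rw [hc, abs_mul, abs_of_pos h2]
    calc (2 : ℚ) ^ N ≤ (2 : ℚ) ^ max K N := pow_le_pow_right₀ (by norm_num) (le_max_right _ _)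
      _ = 1 * (2 : ℚ) ^ max K N := (one_mul _).symm
      _ ≤ |(z : ℚ)| * (2 : ℚ) ^ max K N := mul_le_mul_of_nonneg_right h1 h2.le
  exact absurd hN (not_lt.2 hle)

/-- **FADDEEV'S SEQUENCE (proof of Theorem 6.4): for an order `Λ` of a non-separable `A` there is a sequence
`(Λ_m)_{m ∈ ℕ}` of orders `Λ_m ⊇ Λ` (full lattices with `1 ∈ Λ_m`, `Λ_mΛ_m ⊆ Λ_m`) in which every order occurs
only finitely often** — here `Λ_m := Λ + 2^{-m} r Λ` for a nilpotent `0 ≠ r ∈ Λ ∩ R`, `r² = 0` («`Λ_m := Λ +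
Σ_{l=1}^{n_max} 2^{-lm} (Λ ∩ R)^l`» with one nilpotent); `Λ_m ⊆ Λ_{m'}` for `m ≤ m'`, and `Λ_m = Λ_{m₀}` for
infinitely many `m` would put every `2^{-m} r` into `Λ_{m₀}`. [cite: HertlingLarabi2026, §6 Thm. 6.4 (proof), chunk p0015]
[cite: HertlingLarabi2026b, §5 Rem. 5.11 (i) (5.18), chunk p0010] -/
theorem exists_orders_nat (hA : ¬IsReduced A) {Λ : Submodule ℤ A} (hΛ : IsFullLattice A Λ) (h1 : (1 : A) ∈ Λ)
    (hΛΛ : Λ * Λ ≤ Λ) :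
    ∃ Γ : ℕ → Submodule ℤ A, (∀ k, Λ ≤ Γ k ∧ IsFullLattice A (Γ k) ∧ (1 : A) ∈ Γ k ∧ Γ k * Γ k ≤ Γ k) ∧
      ∀ k₀, {k | Γ k = Γ k₀}.Finite := by
  -- a nilpotent `r ∈ Λ`, `r ≠ 0`, `r² = 0`
  obtain ⟨r₀, hr₀, hr₀2⟩ := exists_ne_zero_mul_self_eq_zero_of_not_isReduced hA
  obtain ⟨N, hN, hNr⟩ := hΛ.2 r₀
  have hr : N • r₀ ≠ 0 := fun h0 => by
    rw [← Int.cast_smul_eq_zsmul ℚ] at h0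
    exact hr₀ ((smul_eq_zero.1 h0).resolve_left (Int.cast_ne_zero.2 hN))
  have hr2 : (N • r₀) * (N • r₀) = 0 := by
    rw [smul_mul_assoc, mul_smul_comm, hr₀2, smul_zero, smul_zero]
  -- the orders `Γ k := Λ + 2^{-k} r Λ`
  obtain ⟨x, hxdef⟩ : ∃ x : ℕ → A, ∀ k, x k = ((2 : ℚ) ^ k)⁻¹ • (N • r₀) := ⟨_, fun k => rfl⟩
  obtain ⟨Γ, hΓdef⟩ : ∃ Γ : ℕ → Submodule ℤ A, ∀ k, Γ k = Λ ⊔ span ℤ {x k} * Λ := ⟨_, fun k => rfl⟩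
  have hle : ∀ k, Λ ≤ Γ k := fun k => by
    rw [hΓdef]
    exact le_sup_left
  have hord : ∀ k, (1 : A) ∈ Γ k ∧ Γ k * Γ k ≤ Γ k := fun k => by
    refine ⟨hle k h1, ?_⟩
    rw [hΓdef]
    refine sup_span_mul_mul_le hΛΛ ?_
    rw [hxdef, smul_mul_assoc, mul_smul_comm, hr2, smul_zero, smul_zero]
  have hfull : ∀ k, IsFullLattice A (Γ k) := fun k => by
    refine ⟨?_, fun d => ?_⟩
    · rw [hΓdef]
      exact hΛ.1.sup ((Submodule.fg_span_singleton _).mul hΛ.1)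
    · obtain ⟨n, hn, hnd⟩ := hΛ.2 d
      exact ⟨n, hn, hle k hnd⟩
  have hxmem : ∀ k, x k ∈ Γ k := fun k => by
    rw [hΓdef]
    refine le_sup_right (a := Λ) ?_
    have h := Submodule.mul_mem_mul (Submodule.mem_span_singleton_self (x k)) h1
    rwa [mul_one] at h
  have hmono : Monotone Γ := by
    refine monotone_nat_of_le_succ fun k => ?_
    rw [hΓdef, hΓdef]
    refine sup_le_sup_left (mul_le_mul' ((Submodule.span_singleton_le_iff_mem _ _).2 ?_) le_rfl) _
    have h2 : (2 : ℚ) * ((2 : ℚ) ^ (k + 1))⁻¹ = ((2 : ℚ) ^ k)⁻¹ := by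
      rw [pow_succ, mul_inv, mul_comm, mul_assoc, inv_mul_cancel₀ (two_ne_zero' ℚ), mul_one]
    have hx : x k = (2 : ℤ) • x (k + 1) := by
      rw [hxdef, hxdef, two_zsmul, ← add_smul, ← two_mul, h2]
    rw [hx]
    exact Submodule.smul_mem _ _ (Submodule.mem_span_singleton_self _)
  refine ⟨Γ, fun k => ⟨hle k, hfull k, hord k⟩, fun k₀ => ?_⟩
  -- if `Γ k = Γ k₀` for infinitely many `k`, then every `2^{-k} r` lies in `Γ k₀`
  by_contra hinf
  have hall : ∀ k, 0 ≤ k → ((2 : ℚ) ^ k)⁻¹ • (N • r₀) ∈ Γ k₀ := fun k _ => by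
    obtain ⟨k', hk', hkk'⟩ := Set.Infinite.exists_gt hinf k
    rw [← hxdef, ← (hk' : Γ k' = Γ k₀)]
    exact hmono hkk'.le (hxmem k)
  exact hr (eq_zero_of_forall_inv_pow_smul_mem (hfull k₀) hall)

/-- **THEOREM 6.4 (Fa65), first statement: «Suppose that `A` is not separable […]. Let `Λ` be an order in `A`. Then
the set `{Γ ∈ 𝓛(A) | Γ an order, Γ ⊃ Λ}` is infinite.»** [cite: HertlingLarabi2026, §6 Thm. 6.4, chunk p0015] -/
theorem infinite_setOf_order_of_not_isReduced (hA : ¬IsReduced A) {Λ : Submodule ℤ A} (hΛ : IsFullLattice A Λ)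
    (h1 : (1 : A) ∈ Λ) (hΛΛ : Λ * Λ ≤ Λ) :
    {Γ : Submodule ℤ A | Λ ≤ Γ ∧ IsFullLattice A Γ ∧ (1 : A) ∈ Γ ∧ Γ * Γ ≤ Γ}.Infinite := by
  obtain ⟨Γ, hΓ, hfib⟩ := exists_orders_nat hA hΛ h1 hΛΛ
  intro hfin
  haveI : Finite {Γ' : Submodule ℤ A | Λ ≤ Γ' ∧ IsFullLattice A Γ' ∧ (1 : A) ∈ Γ' ∧ Γ' * Γ' ≤ Γ'} :=
    hfin.to_subtype
  obtain ⟨y, hy⟩ := Finite.exists_infinite_fiber fun k : ℕ =>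
    (⟨Γ k, hΓ k⟩ : {Γ' : Submodule ℤ A | Λ ≤ Γ' ∧ IsFullLattice A Γ' ∧ (1 : A) ∈ Γ' ∧ Γ' * Γ' ≤ Γ'})
  have hinf := Set.infinite_coe_iff.1 hy
  obtain ⟨k₀, hk₀⟩ := hinf.nonempty
  refine (hinf.mono fun k hk => ?_) (hfib k₀)
  have hk' := (Set.mem_singleton_iff.1 (Set.mem_preimage.1 hk)).trans
    (Set.mem_singleton_iff.1 (Set.mem_preimage.1 hk₀)).symm
  exact congrArg Subtype.val hk'

/-- **THEOREM 6.4 (Fa65), second statement: «And therefore the set `{[L]_ε | L ∈ 𝓛(A), 𝒪(L) ⊃ Λ}` is infinite»**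
— «`Λ_1, Λ_2` orders with `[Λ_1]_ε = [Λ_2]_ε ⟹ Λ_1 = Λ_2`» (`eq_of_units_smul_eq_of_one_mem`), and each order
`Γ ⊇ Λ` is a full lattice with `ΓΛ ⊆ Γ`. [cite: HertlingLarabi2026, §6 Thm. 6.4 and the «basic observation» of its proof, chunk p0015] -/
theorem infinite_quot_isFullLattice_of_not_isReduced (hA : ¬IsReduced A) {Λ : Submodule ℤ A}
    (hΛ : IsFullLattice A Λ) (h1 : (1 : A) ∈ Λ) (hΛΛ : Λ * Λ ≤ Λ) :
    Infinite (Quot fun M M' : {M : Submodule ℤ A // IsFullLattice A M ∧ ∀ m ∈ M, ∀ a ∈ Λ, m * a ∈ M} =>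
      ∃ u : Aˣ, u • M.1 = M'.1) := by
  obtain ⟨Γ, hΓ, hfib⟩ := exists_orders_nat hA hΛ h1 hΛΛ
  have hP : ∀ k, IsFullLattice A (Γ k) ∧ ∀ m ∈ Γ k, ∀ a ∈ Λ, m * a ∈ Γ k := fun k =>
    ⟨(hΓ k).2.1, fun m hm a ha => (hΓ k).2.2.2 (Submodule.mul_mem_mul hm ((hΓ k).1 ha))⟩
  rw [← not_finite_iff_infinite]
  intro hfin
  obtain ⟨y, hy⟩ := Finite.exists_infinite_fiber fun k : ℕ =>
    Quot.mk (fun M M' : {M : Submodule ℤ A // IsFullLattice A M ∧ ∀ m ∈ M, ∀ a ∈ Λ, m * a ∈ M} =>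
      ∃ u : Aˣ, u • M.1 = M'.1) ⟨Γ k, hP k⟩
  have hinf := Set.infinite_coe_iff.1 hy
  obtain ⟨k₀, hk₀⟩ := hinf.nonempty
  refine (hinf.mono fun k hk => ?_) (hfib k₀)
  have hkk := (Set.mem_singleton_iff.1 (Set.mem_preimage.1 hk)).trans
    (Set.mem_singleton_iff.1 (Set.mem_preimage.1 hk₀)).symm
  obtain ⟨u, hu⟩ := (equivalence_exists_units_smul _).eqvGen_iff.1 (Quot.eqvGen_exact hkk)
  exact eq_of_units_smul_eq_of_one_mem u hu (hΓ k).2.2.1 (hΓ k).2.2.2 (hΓ k₀).2.2.1 (hΓ k₀).2.2.2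

/-! ## §3 The dichotomy -/

/-- **THEOREMS 6.3 AND 6.4 TOGETHER: for an order `Λ` of `A`, the `ε`-classes of full lattices `M` with `MΛ ⊆ M`
(`𝒪(M) ⊇ Λ`) form a finite type iff `A` is separable (`R = 0`).** [cite: HertlingLarabi2026, §6 Thms. 6.3–6.4, chunk p0015] -/
theorem finite_quot_isFullLattice_iff_isReduced [Module.Finite ℚ A] {Λ : Submodule ℤ A} (hΛ : IsFullLattice A Λ)
    (h1 : (1 : A) ∈ Λ) (hΛΛ : Λ * Λ ≤ Λ) :
    Finite (Quot fun M M' : {M : Submodule ℤ A // IsFullLattice A M ∧ ∀ m ∈ M, ∀ a ∈ Λ, m * a ∈ M} =>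
      ∃ u : Aˣ, u • M.1 = M'.1) ↔ IsReduced A := by
  refine ⟨fun h => ?_, fun hA => ?_⟩
  · by_contra hA
    exact not_finite_iff_infinite.2 (infinite_quot_isFullLattice_of_not_isReduced hA hΛ h1 hΛΛ) h
  · haveI := hA
    exact finite_quot_isFullLattice_of_isReduced Λ hΛ

end Literature.NumberTheory.ComplexMultiplication.FiniteQAlgebraLattice
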